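import Summits.HodgeConjecture.HodgeConjecture.Theorems.Ring2WeilCoverageTowerLaw
import HarnessLib

/-!
# Weil-type family coverage — THEOREM J (the class law of the Johnson pieces) and the completeness of its budget scan (ring2-b02, gen 71)

research route conditional on HC_CM; not a corollary; Q11.4-sentence-2 already refuted in dim ≥ 3.

Ring 2, WEIL-TYPE FAMILY-COVERAGE CENSUS (`HOME/WEIL-FAMILY-COVERAGE.md` `## b02 (g = 6)`, block b02.31, owner ring2-b02).
Block b02.31 treats the first O'Nan–Scott piece beyond the block pieces (COROLLARY Z1) and the product action (COROLLARY Z2) of the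
retirement handoff b02.29.9 (1): the JOHNSON pieces — `G₂ ∈ {S_n, A_n}` acting on `k`-subsets, hidden factor `B_k` of the two-row
Specht module `S^{(n−k,k)}` twisted by a carrier `(G₁, λ)` with ring2-b04's LEMMA C′.  The stabiliser `S_k × S_{n−k}` is maximal, so
THEOREM Z has no intermediate subgroup to work with; the block compares the TWO towers `S_k × S_{n−k} ≤ S_n` and
`S_{k−1} × S_{n−k+1} ≤ S_n` inside the one hermitian space `U(C̃)` and moves the lower hidden factors between the two invariant lines
of each `S^{(n−j,j)}` (`j < k`) by Schur's lemma; the ratio of the two line norms is a Johnson-scheme constant (LEMMA J0).  Result: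

  **THEOREM J.**  `cl(B_k) = [k(n−k+1)]^{r₀} · ∏_{j=1}^{k−1} [(k−j)(n−k−j+1)]^{m_j} · [|S_k × S_{n−k}|·u]^{m_k}`
  (`m_j = dim_K B_j`, `r₀ = m₀ = dim_K U(C̃/S_n)`; for a sixfold `m_k = 6` and the last factor is `1`).

This file checks in the kernel the finite algebra and arithmetic behind it (full text `weilcov/g71/doc/theoremJ.md`):
* §1 the two-tower bookkeeping in the norm-residue group `ℚˣ/Nm(Kˣ)` (exponent 2): `towerPair`, `towerPair_even`;
* §2 LEMMA J0's square classes: `[|P_k|·|P_{k−1}|] = [k(n−k+1)]` (`stabiliser_orders_mul`) and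
  `[C(n,k)·C(n,k−1)] = [k(n−k+1)]` (`choose_mul_choose_pred`), whence the line-norm ratio `ρ_j = [k(n−k+1)]·[(k−j)(n−k−j+1)]`;
* §3 LEMMA N (the relaxation scan is complete in the number of branch points): the carrier-slot count bound and the monotonicity of the
  margin in the number of pure slots (`carrier_slots_le`, `margin_step_neg`), and the budget identity (`budget_iff`);
* §4 COROLLARY J1's smallest residual-reach cells, as integer identities modulo squares and explicit norms:
  `W6.2.91` at `(n,k) = (15,2), (16,3)`; `W6.7.221` at `(21,5)`; `W6.11.34 / 17 / 91` at `(18,2) / (19,2) / (15,2)`.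

Nothing in this file is a statement about Hodge classes; `HC_CM` is used nowhere; no `def`, no named fact.
References: [cite: vanGeemen1994HodgeAV, 5.2 and (5.4.1)]; [cite: Serre1973, Ch. III §1].
-/

noncomputable section

set_option linter.dupNamespace false

namespace Summit.HodgeConjecture.HodgeConjecture.Ring2.WeilCoverage

namespace JohnsonClassLaw

/-! ### §1 THEOREM J — the two-tower bookkeeping in an elementary abelian 2-group -/

/-- **THEOREM J, the algebraic step.**  In the norm-residue group (every class an involution) let
`x₀` = `cl(U^{S_n})`, `A` = the class of the lower hidden factors `⊕_{0<j<k} X_j` measured on the `S_{k−1} × S_{n−k+1}`-invariant lines,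
`A·ρ` the same measured on the `S_k × S_{n−k}`-invariant lines (Schur: each `X_j` rescales by the line-norm ratio, `ρ = ∏ ρ_j^{m_j}`),
`B` = `cl(B_k)`.  LEMMA B + LEMMA C′ for the two stabilisers (`p = [|P_k|]`, `p' = [|P_{k−1}|]`, ranks `R' = r(C̃/P_{k−1})`,
`R' + m` = `r(C̃/P_k)`):  `(p'u)^{R'} = x₀·A` and `(pu)^{R'+m} = x₀·(A·ρ)·B`.  Then `B = (p·p')^{R'}·ρ·(p·u)^{m}`.
research route conditional on HC_CM; not a corollary; Q11.4-sentence-2 already refuted in dim ≥ 3. [cite: vanGeemen1994HodgeAV, (5.4.1)] -/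
theorem towerPair {G : Type*} [CommGroup G] (h2 : ∀ g : G, g * g = 1) {p p' u x₀ A ρ B : G} {R' m : ℕ}
    (hlow : (p' * u) ^ R' = x₀ * A) (hup : (p * u) ^ (R' + m) = x₀ * (A * ρ) * B) :
    B = (p * p') ^ R' * ρ * (p * u) ^ m := by
  have hinv : ∀ g : G, g⁻¹ = g := TowerLaw.inv_eq_self_of_sq h2
  have hB : B = (x₀ * (A * ρ))⁻¹ * (p * u) ^ (R' + m) := by
    rw [hup, ← mul_assoc, inv_mul_cancel, one_mul]
  have hx : x₀ * A = (p' * u) ^ R' := hlow.symm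
  calc B = (x₀ * (A * ρ))⁻¹ * (p * u) ^ (R' + m) := hB
    _ = (x₀ * A * ρ)⁻¹ * (p * u) ^ (R' + m) := by rw [mul_assoc]
    _ = ((p' * u) ^ R' * ρ)⁻¹ * (p * u) ^ (R' + m) := by rw [hx]
    _ = ((p' * u) ^ R' * ρ) * (p * u) ^ (R' + m) := by rw [hinv]
    _ = ((p' * u) ^ R' * (p * u) ^ R') * ρ * (p * u) ^ m := by rw [pow_add]; simp only [mul_assoc, mul_comm, mul_left_comm]
    _ = (p * p') ^ R' * ρ * (p * u) ^ m := by
        congr 2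
        rw [← mul_pow]; congr 1
        calc p' * u * (p * u) = (p * p') * (u * u) := by simp only [mul_comm, mul_left_comm]
          _ = p * p' := by rw [h2 u, mul_one]

/-- **THEOREM J for a sixfold (even `m_k`):** `cl(B_k) = (p·p')^{R'}·ρ` — with §2, `[p·p'] = [k(n−k+1)]` and
`ρ = ∏_{0<j<k} ([k(n−k+1)]·[(k−j)(n−k−j+1)])^{m_j}`, and `R' + Σ_{0<j<k} m_j ≡ r₀ (mod 2)`, this is the displayed class law.
research route conditional on HC_CM; not a corollary; Q11.4-sentence-2 already refuted in dim ≥ 3. [cite: vanGeemen1994HodgeAV, (5.4.1)] -/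
theorem towerPair_even {G : Type*} [CommGroup G] (h2 : ∀ g : G, g * g = 1) {p p' u x₀ A ρ B : G} {R' m : ℕ} (hm : Even m)
    (hlow : (p' * u) ^ R' = x₀ * A) (hup : (p * u) ^ (R' + m) = x₀ * (A * ρ) * B) :
    B = (p * p') ^ R' * ρ := by
  rw [towerPair h2 hlow hup, TowerLaw.pow_even_eq_one h2 _ hm, mul_one]

/-- The parity merge in the exponent: `[c]^{R'}·[c]^{M} = [c]^{R' + M}` and `R' = r₀ + M` ⟹ exponent `r₀ + 2M ≡ r₀`:
in an exponent-2 group `c^{r₀ + M + M} = c^{r₀}`.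
research route conditional on HC_CM; not a corollary; Q11.4-sentence-2 already refuted in dim ≥ 3. [folklore] -/
theorem pow_add_twice {G : Type*} [CommGroup G] (h2 : ∀ g : G, g * g = 1) (c : G) (r₀ M : ℕ) :
    c ^ (r₀ + M + M) = c ^ r₀ := by
  rw [add_assoc, pow_add, ← two_mul, TowerLaw.pow_even_eq_one h2 c (even_two_mul M), mul_one]

/-! ### §2 LEMMA J0 — the square classes of the stabiliser orders and of the Johnson line norms -/

/-- `|P_k|·|P_{k−1}| = k!(n−k)!·(k−1)!(n−k+1)!` is `k(n−k+1)` times a square (written with `k = a+1`, `n − k = b`):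
`(a+1)!·b!·(a!·(b+1)!) = (a+1)(b+1)·(a!·b!)²`, so `[|P_k|/|P_{k−1}|] = [|P_k|·|P_{k−1}|] = [k(n−k+1)]` modulo squares.
research route conditional on HC_CM; not a corollary; Q11.4-sentence-2 already refuted in dim ≥ 3. [folklore] -/
theorem stabiliser_orders_mul (a b : ℕ) :
    (a + 1).factorial * b.factorial * (a.factorial * (b + 1).factorial)
      = (a + 1) * (b + 1) * (a.factorial * b.factorial) ^ 2 := by
  rw [Nat.factorial_succ, Nat.factorial_succ]; ring

/-- `C(n,k)·C(n,k−1)` is `k(n−k+1)` times a square (with `k = a+1`): from Mathlib's `C(n,a+1)(a+1) = C(n,a)(n−a)`,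
`(a+1)(n−a)·C(n,a+1)·C(n,a) = ((n−a)·C(n,a))²`.  Together with the Wilson constant `C(n−2j, k−j)` of the embedded copies
(checked by exact linear algebra in `johnson.py selftest (T1b)`), the line-norm ratio is `ρ_j = [k(n−k+1)]·[(k−j)(n−k−j+1)]`.
research route conditional on HC_CM; not a corollary; Q11.4-sentence-2 already refuted in dim ≥ 3. [folklore] -/
theorem choose_mul_choose_pred (n a : ℕ) :
    (a + 1) * (n - a) * (n.choose (a + 1) * n.choose a) = ((n - a) * n.choose a) ^ 2 := by
  have h := Nat.choose_succ_right_eq n a   -- n.choose (a+1) * (a+1) = n.choose a * (n - a)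
  calc (a + 1) * (n - a) * (n.choose (a + 1) * n.choose a)
        = (n - a) * (n.choose (a + 1) * (a + 1)) * n.choose a := by ring
    _ = (n - a) * (n.choose a * (n - a)) * n.choose a := by rw [h]
    _ = ((n - a) * n.choose a) ^ 2 := by ring

/-- The norm of the projected basis vector: `‖proj_j e_B‖² = d_j / C(n,k)` has the square class of `d_j·C(n,k)` —
`x/y` and `x·y` agree modulo squares for positive rationals (`x/y = x·y / y²`).
research route conditional on HC_CM; not a corollary; Q11.4-sentence-2 already refuted in dim ≥ 3. [folklore] -/
theorem div_eq_mul_div_sq (x y : ℚ) (hy : y ≠ 0) : x / y = (x * y) / y ^ 2 := by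
  field_simp

/-! ### §3 LEMMA N — completeness of the relaxation scan in the number of branch points; the budget identity -/

/-- **The budget identity.** With `w_j = d − Fix_j` over `N` slots, `Σ w_j = 2d + 6 ⟺ Σ Fix_j = (N−2)d − 6` (b02.21 (P1):
`m = Σ_j w_j − 2d` for every `N`).  Stated for the totals `W = Σ w_j`, `F = Σ Fix_j`, `W + F = N·d`.
research route conditional on HC_CM; not a corollary; Q11.4-sentence-2 already refuted in dim ≥ 3. [folklore] -/
theorem budget_iff (N d W F : ℤ) (h : W + F = N * d) : W = 2 * d + 6 ↔ F = (N - 2) * d - 6 := by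
  constructor <;> intro h' <;> linarith

/-- **LEMMA N (i), the carrier-slot bound.** If each of `c` non-identity carrier slots has `Fix ≤ M < d` and the budget
`(c − 2)·d − 6 ≤ Σ Fix ≤ c·M` is met, then `c·(d − M) ≤ 2d + 6` (so `c ≤ ⌊(2d+6)/(d−M)⌋`: `4` for `GL₂(3)`/`SD₁₆`, `≤ 6` always in range).
research route conditional on HC_CM; not a corollary; Q11.4-sentence-2 already refuted in dim ≥ 3. [folklore] -/
theorem carrier_slots_le (c d M : ℤ) (h : (c - 2) * d - 6 ≤ c * M) : c * (d - M) ≤ 2 * d + 6 := by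
  linarith

/-- **LEMMA N (ii), monotonicity in the pure slots.** Adding a pure `G₂`-slot raises the attainable `Σ Fix` by at most
`M₁ = d − f·μ(λ) < d` and the target by `d`: the margin drops by `d − M₁ > 0`.  Hence if the margin of `(σ, p)` is negative, so is
that of `(σ, p')` for every `p' ≥ p`, and the scan over `p ≤ p_max(σ)` is complete.
research route conditional on HC_CM; not a corollary; Q11.4-sentence-2 already refuted in dim ≥ 3. [folklore] -/
theorem margin_step_neg (S M₁ d t margin : ℤ) (hM : M₁ < d) (hmargin : margin = S - t) :
    (S + M₁) - (t + d) < margin := by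
  rw [hmargin]; linarith

/-- **LEMMA N (iii), at most four non-identity slots for the rank-two carriers.** For `GL₂(3)` and `SD₁₆` every non-central
element has two distinct eigenvalues, so `Fix(h : y) ≤ d/2` (`2·Fix ≤ d`); five such slots cannot meet `Σ Fix = 3d − 6` once `d > 12`.
research route conditional on HC_CM; not a corollary; Q11.4-sentence-2 already refuted in dim ≥ 3. [folklore] -/
theorem five_rank_two_slots_infeasible (d F₁ F₂ F₃ F₄ F₅ : ℤ) (hd : 12 < d)
    (h₁ : 2 * F₁ ≤ d) (h₂ : 2 * F₂ ≤ d) (h₃ : 2 * F₃ ≤ d) (h₄ : 2 * F₄ ≤ d) (h₅ : 2 * F₅ ≤ d) :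
    F₁ + F₂ + F₃ + F₄ + F₅ ≠ 3 * d - 6 := by
  intro h; linarith

/-! ### §4 COROLLARY J1 — the smallest residual-reach cells, as identities modulo squares and norms -/

/-- `W6.2.91` / `W6.11.91` at `(n,k) = (15,2)`: base `[2·14]·[13] = [28·13]`, and `28·13 = 91·2²`.
research route conditional on HC_CM; not a corollary; Q11.4-sentence-2 already refuted in dim ≥ 3. [folklore] -/
theorem reach_15_2 : 28 * 13 = 91 * 2 ^ 2 := by norm_num

/-- `W6.2.91` at `(n,k) = (16,3)`: base `[3·14]·[2·13] = [42·26]`, `42·26 = 91·3·2²`, and `3 = 1² + 2·1²` is a norm from `ℚ(√−2)`,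
so `[42·26] = [91]` in `ℚˣ/Nm(ℚ(√−2)ˣ)`.
research route conditional on HC_CM; not a corollary; Q11.4-sentence-2 already refuted in dim ≥ 3. [folklore] -/
theorem reach_16_3 : 42 * 26 = 91 * 3 * 2 ^ 2 ∧ (3 : ℤ) = 1 ^ 2 + 2 * 1 ^ 2 := by
  constructor <;> norm_num

/-- `W6.7.221` at `(n,k) = (21,5)` (the SMALLEST Johnson cell whose THEOREM-J class can be `[221]` over `ℚ(√−7)`; `d = 3·14364`):
base classes `[5·17], [4·16], [3·15], [2·14], [1·13]` with parity support `{r₀, m₂, m₄}`: `85·45·13 = 221·15²`.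
research route conditional on HC_CM; not a corollary; Q11.4-sentence-2 already refuted in dim ≥ 3. [folklore] -/
theorem reach_21_5 : 85 * 45 * 13 = 221 * 15 ^ 2 ∧ Nat.choose 21 5 - Nat.choose 21 4 = 14364 := by
  constructor
  · norm_num
  · decide

/-- `W6.11.34` at `(18,2)` (`[2·17] = [34]`, support `{r₀}`), `W6.11.17` at `(19,2)` (`[n−2] = [17]`, support `{m₁}`),
and the dimensions `d_λ = n(n−3)/2 = 135, 152` (`d = 5·d_λ` for the `η₅` carrier).
research route conditional on HC_CM; not a corollary; Q11.4-sentence-2 already refuted in dim ≥ 3. [folklore] -/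
theorem reach_18_19_2 : 2 * (18 - 1) = 34 ∧ 19 - 2 = 17 ∧ Nat.choose 18 2 - 18 = 135 ∧ Nat.choose 19 2 - 19 = 152 := by
  refine ⟨by norm_num, by norm_num, by decide, by decide⟩

/-! ### §5 THEOREM J2 (pair windows, all `n`) — LEMMA μ, the uniform caps, and the tight signatures (gen 71, same session) -/

/-- **LEMMA μ, odd prime order.**  For `g ∈ S_n` of prime order `p ≥ 3` with `a ≥ 1` cycles and `b` fixed points (`n = ap + b`), the
codimension of the fixed space of `g` on `S^{(n−2,2)}` is `a(p−1)(n+b−3)/2` (pair-orbit count), and this is `≥ n − 3`: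
`2(n−3) ≤ a(p−1)(n+b−3)`.
research route conditional on HC_CM; not a corollary; Q11.4-sentence-2 already refuted in dim ≥ 3. [folklore] -/
theorem lemmaMu_odd (a p b n : ℕ) (ha : 1 ≤ a) (hp : 3 ≤ p) (hn : n = a * p + b) (h3 : 3 ≤ n) :
    2 * (n - 3) ≤ a * (p - 1) * (n + b - 3) := by
  subst hn
  have h1 : 2 ≤ p - 1 := by omega
  have h2 : a * p + b - 3 ≤ a * p + b + b - 3 := by omega
  calc 2 * (a * p + b - 3) ≤ (a * (p - 1)) * (a * p + b - 3) := by
        have : 2 ≤ a * (p - 1) := le_trans h1 (Nat.le_mul_of_pos_left (p - 1) ha)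
        exact Nat.mul_le_mul_right _ this
    _ ≤ a * (p - 1) * (a * p + b + b - 3) := Nat.mul_le_mul_left _ h2

/-- **LEMMA μ, involutions.**  For an involution with `a ≥ 1` two-cycles on `n ≥ a + 3` letters the codimension of its fixed space on
`S^{(n−2,2)}` is `a(n−a−2)`, and `a(n−a−2) − (n−3) = (a−1)(n−a−3) ≥ 0`; hence (with `Fix(g) ⊆ Fix(g^m)`) every `g ≠ 1` has
`codim Fix(g | S^{(n−2,2)}) ≥ n − 3` — the minimal degree of the two-row module, attained by transpositions.
research route conditional on HC_CM; not a corollary; Q11.4-sentence-2 already refuted in dim ≥ 3. [folklore] -/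
theorem lemmaMu_two (a n : ℤ) (ha : 1 ≤ a) (hn : a + 3 ≤ n) : n - 3 ≤ a * (n - a - 2) := by
  nlinarith

/-- **THEOREM J2, the `GL₂(3)` certificate.**  Uniform caps (LP duality on `E_1 + Σ φ(b)E_b = d_λ`, `E_b ≤ C/b`):
`Fix(2B:y) ≤ d_λ`, `Fix(3A:y) ≤ 2C/3`, `Fix(8:y) ≤ C/4` with `d_λ = n(n−3)/2`, `C = n(n−1)/2`; the worst signature `(2B,3A,8)` has
cap-margin `d_λ + 2C/3 + C/4 − (2d_λ − 6) = (−n² + 25n)/24 + 6 < 0` for `n ≥ 30` (`n² − 25n − 144 > 0`).  Integer form: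
research route conditional on HC_CM; not a corollary; Q11.4-sentence-2 already refuted in dim ≥ 3. [folklore] -/
theorem gl23_pair_window_margin (n : ℤ) (hn : 30 ≤ n) : 11 * (n * (n - 1)) + 12 * 12 < 12 * (n * (n - 3)) := by
  nlinarith

/-- The `PSL₂(7)` certificate: worst non-tight signatures `(2A,3A,7)`, `(2A,4A,7)` with caps `d_λ + C/2`, `d_λ`, `3C/7`:
margin `C/2 + 3C/7 − d_λ + 6 = (13·n(n−1) − 14·n(n−3))/28 + 6 < 0` for `n ≥ 34` (`n² − 29n − 168 > 0`).
research route conditional on HC_CM; not a corollary; Q11.4-sentence-2 already refuted in dim ≥ 3. [folklore] -/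
theorem l27_pair_window_margin (n : ℤ) (hn : 34 ≤ n) : 13 * (n * (n - 1)) + 28 * 6 < 14 * (n * (n - 3)) := by
  nlinarith

/-- **The tight signatures** (`PSL₂(7)`: `(3,3,4)`, `(3,4,4)`, `(4,4,4)`; `F₂₁`: `(3a,3a,3a)`, `(3b,3b,3b)`; `η₅`: `(2,5,5)`, `(2,5,6)`,
`(2,6,6)`, `(2)^5`): the caps sum to exactly `(c−2)d`, so the slot deficits sum to `6`; each deficit is `0` or `≥ n − 3` (LEMMA μ applied to
`y^{o}`), so for `n ≥ 10` every deficit vanishes — contradiction with the sum `6`.  The arithmetic: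
research route conditional on HC_CM; not a corollary; Q11.4-sentence-2 already refuted in dim ≥ 3. [folklore] -/
theorem tight_signature_infeasible (n : ℕ) (hn : 10 ≤ n) (δ₁ δ₂ δ₃ : ℕ)
    (h₁ : δ₁ = 0 ∨ n - 3 ≤ δ₁) (h₂ : δ₂ = 0 ∨ n - 3 ≤ δ₂) (h₃ : δ₃ = 0 ∨ n - 3 ≤ δ₃) : δ₁ + δ₂ + δ₃ ≠ 6 := by
  omega

end JohnsonClassLaw

end Summit.HodgeConjecture.HodgeConjecture.Ring2.WeilCoverage

end
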